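import Literature.Analysis.FluidPDE.AxisymmetricL3OffAxis
import Literature.Analysis.FluidPDE.KNSSNoAxisymmetricTypeIHolds
import Literature.Analysis.FluidPDE.NSBoundedHigherRegularity
import Literature.Analysis.FluidPDE.KNSSLocalSmoothingHolds
import Summits.NavierStokesRegularity.NavierStokesRegularity.Theorems.CertifiedBlowupCertifiedBlowupAxisymBlowupBlowupSet
import HarnessLib

/-!
# Higher regularity at the regular top points of a witness of the crux `CertifiedBlowupAxisymBlowup`

Theorems file landed `--supports stmt-NavierStokesRegularity-0727`, line `compact-amplification`
(continuation lead c3, wave 3). A witness of the crux is a classical solution `(u, p)` of the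
unforced Navier–Stokes system (`ν > 0`) on `[0, T)`, Leray–Hopf on `[0, T]` from its rapidly
decaying axisymmetric datum `u 0`. This file proves, from PROVED tree theorems only, that local
boundedness of `u` on a backward parabolic neighbourhood `(T - r², T) × B(x₀, r)` of a top point
`(T, x₀)` (`IsBoundedNearTop u T x₀`) upgrades to boundedness of ALL spatial derivatives
`Dⁿu(t)` on a (smaller) backward parabolic neighbourhood of `(T, x₀)`
(`iteratedFDeriv_bounded_near_top_of_isBoundedNearTop`, registered stub): outside the blow-up set
the witness is `Cᵏ`-bounded up to the blow-up time.

The argument: with the gauged pressure `q` of `AxisymmetricL3Hyp.exists_gauged_pressure`, the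
viscosity-normalising parabolic rescaling `v(s, y) = (R/ν) u(T + (R²/ν) s, x₀ + R y)`,
`π = (R/ν)² q ∘ Φ` about `(T, x₀)` is a suitable weak (hence distributional) solution of the
unit-viscosity system on `Q(0, 1)` with `π ∈ L^{3/2}(Q(0, 1))` (verbatim from
`axisymmetricL3_boundedNearTop_offAxis_of_seregin`) and `|v| ≤ (R/ν) K₀` there once the
`ν`-cylinder `(T - R²/ν, T) × B(x₀, R)` lies in the region of boundedness; the higher interior
regularity of bounded distributional solutions (`NSBoundedHigherRegularity_holds`, Seregin–Šverák
2009 §2 p. 8 = KNSS 2009 §4 / Serrin 1962) gives a representative `V = v` a.e. on `Q(0, 1)` all of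
whose spatial derivatives are uniformly Hölder, hence bounded, on `Q(0, 1/2)`; `V = v` everywhere
on `Q(0, 1)` since both are continuous there, and the derivative bounds are transported back to `u`
along the affine change of variables (`Dⁿ[a g(b(· - x₀))] = a bⁿ (Dⁿg) ∘ …`, in norm).

No new definitions, no named-fact hypotheses, no `sorry`.

## References

* G. Koch, N. Nadirashvili, G. Seregin, V. Šverák, *Liouville theorems for the Navier–Stokes
  equations and applications*, Acta Math. 203 (2009) = arXiv:0709.3599, §4 (regularity of
  bounded mild solutions). [KochNadirashviliSereginSverak2009]
* J. Serrin, *On the interior regularity of weak solutions of the Navier–Stokes equations*,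
  Arch. Rational Mech. Anal. 9 (1962) 187–195. [Serrin1962]
* G. Seregin, V. Šverák, Comm. PDE 34 (2009) = arXiv:0804.1803, §2 p. 8, §3. [SereginSverak2009]
-/

-- the summit and its single problem share the name (D-0017 nested layout)
set_option linter.dupNamespace false

noncomputable section

open MeasureTheory Set Function Filter Topology Metric
open scoped ENNReal NNReal

namespace Summit.NavierStokesRegularity.NavierStokesRegularity.Theorems.CertifiedBlowupAxisymBlowup.CompactAmplification

open Literature.Analysis.FluidPDE

/-! ### Two pieces of calculus bookkeeping -/

/-- Membership in the standard backward cylinder `Q(0, r) = (-r², 0) × B(0, r)`. [folklore] -/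
theorem mem_parabolicCylinder_zero_iff {r : ℝ} {w : ℝ × EuclideanSpace ℝ (Fin 3)} :
    w ∈ parabolicCylinder r (0 : ℝ × EuclideanSpace ℝ (Fin 3)) ↔
      (-r ^ 2 < w.1 ∧ w.1 < 0) ∧ ‖w.2‖ < r := by
  rw [mem_parabolicCylinder, Prod.fst_zero, Prod.snd_zero, zero_sub, dist_zero_right]

/-- **A uniformly Hölder function on the half cylinder `Q(0, 1/2)` is bounded there**: any two
points of `Q(0, 1/2)` are at (sup-)distance at most `1`, so `‖G w‖ ≤ ‖G w₀‖ + C` for the fixed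
point `w₀ = (-1/8, 0)`. [folklore] -/
theorem exists_forall_norm_le_of_holderOnWith_half {F : Type*} [NormedAddCommGroup F] {C a : ℝ≥0}
    {G : ℝ × EuclideanSpace ℝ (Fin 3) → F}
    (hG : HolderOnWith C a G (parabolicCylinder (1 / 2) (0 : ℝ × EuclideanSpace ℝ (Fin 3)))) :
    ∃ K : ℝ, ∀ w ∈ parabolicCylinder (1 / 2) (0 : ℝ × EuclideanSpace ℝ (Fin 3)), ‖G w‖ ≤ K := by
  have hw₀ : ((-(1 / 8) : ℝ), (0 : EuclideanSpace ℝ (Fin 3))) ∈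
      parabolicCylinder (1 / 2) (0 : ℝ × EuclideanSpace ℝ (Fin 3)) := by
    rw [mem_parabolicCylinder_zero_iff, norm_zero]
    norm_num
  refine ⟨‖G ((-(1 / 8) : ℝ), (0 : EuclideanSpace ℝ (Fin 3)))‖ + C, fun w hw => ?_⟩
  have hw' := hw
  rw [mem_parabolicCylinder_zero_iff] at hw'
  obtain ⟨⟨h1, h2⟩, h3⟩ := hw'
  have hd : dist w ((-(1 / 8) : ℝ), (0 : EuclideanSpace ℝ (Fin 3))) ≤ 1 := by
    rw [Prod.dist_eq]
    refine max_le ?_ ?_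
    · show dist w.1 (-(1 / 8)) ≤ 1
      rw [Real.dist_eq, abs_le]
      constructor <;> nlinarith
    · show dist w.2 0 ≤ 1
      rw [dist_zero_right]
      linarith
  have hle := hG.dist_le_of_le hw hw₀ hd
  rw [Real.one_rpow, mul_one, dist_eq_norm] at hle
  calc ‖G w‖ ≤ ‖G ((-(1 / 8) : ℝ), (0 : EuclideanSpace ℝ (Fin 3)))‖ +
      ‖G w - G ((-(1 / 8) : ℝ), (0 : EuclideanSpace ℝ (Fin 3)))‖ := norm_le_norm_add_norm_sub' _ _
    _ ≤ _ := by linarith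

/-- **Unscaling a slice through the affine change of variables, in norm**: for any `g`, any `a`
and `b ≠ 0`, `‖Dⁿ[x' ↦ a • g (b • (x' - x₀))](x)‖ ≤ |a| |b|ⁿ ‖Dⁿg (b • (x - x₀))‖` (no
differentiability hypothesis: constants come out of `iteratedFDeriv` over `ℝ`, translations
commute with it, and the homothety is a linear automorphism). [folklore] -/
theorem norm_iteratedFDeriv_smul_comp_affine_le {F : Type*} [NormedAddCommGroup F] [NormedSpace ℝ F]
    (g : EuclideanSpace ℝ (Fin 3) → F) (a : ℝ) {b : ℝ} (hb : b ≠ 0) (x₀ : EuclideanSpace ℝ (Fin 3))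
    (n : ℕ) (x : EuclideanSpace ℝ (Fin 3)) :
    ‖iteratedFDeriv ℝ n (fun x' => a • g (b • (x' - x₀))) x‖ ≤
      |a| * |b| ^ n * ‖iteratedFDeriv ℝ n g (b • (x - x₀))‖ := by
  have h1 : iteratedFDeriv ℝ n (fun x' => a • g (b • (x' - x₀))) x =
      a • iteratedFDeriv ℝ n (fun x' => g (b • (x' - x₀))) x := by
    rw [iteratedFDeriv_const_smul_real (fun x' => g (b • (x' - x₀))) a n]
  have h2 : iteratedFDeriv ℝ n (fun x' => g (b • (x' - x₀))) x =
      iteratedFDeriv ℝ n (fun y => g (b • y)) (x - x₀) :=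
    iteratedFDeriv_comp_sub (f := fun y => g (b • y)) n x₀ x
  rw [h1, norm_smul, Real.norm_eq_abs, h2, mul_assoc]
  exact mul_le_mul_of_nonneg_left (norm_iteratedFDeriv_comp_smul_le g hb n (x - x₀)) (abs_nonneg a)

/-! ### The rescaled solution about a regular top point -/

section Witness

variable {ν T : ℝ} {u : ℝ → EuclideanSpace ℝ (Fin 3) → EuclideanSpace ℝ (Fin 3)}
  {p : ℝ → EuclideanSpace ℝ (Fin 3) → ℝ}

/-- **Derivative bounds for the viscosity-normalised rescaling about a regular top point.** Under
the standing hypotheses `AxisymmetricL3Hyp`, let `0 < R ≤ ρ`, `R²/ν ≤ ρ² ≤ T`, and let `u` be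
bounded by `K₀` on the backward cylinder `Q((T, x₀), ρ)`. Then every spatial derivative of the
rescaled field `v(s, y) = (R/ν) u(T + (R²/ν) s, x₀ + R y)` is bounded on `Q(0, 1/2)`: `(v, π)`,
`π = (R/ν)² q ∘ Φ` (`q` the gauged pressure), is a distributional solution of the unit-viscosity
system on `Q(0, 1)` (`IsSuitableWeakSolutionOn.stRescale`) with `|v| ≤ (R/ν) K₀` and
`π ∈ L^{3/2}(Q(0, 1))` (`lintegral_cylinder_gauged_pressure_lt_top`), so
`NSBoundedHigherRegularity_holds` provides a representative with uniformly Hölder — hence bounded —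
spatial derivatives on `Q(0, 1/2)`, which agrees with the continuous `v` everywhere on `Q(0, 1)`.
[cite: KochNadirashviliSereginSverak2009, §4 (regularity of bounded mild solutions)]
[cite: SereginSverak2009, §2 p. 8 and §3] -/
theorem exists_forall_norm_iteratedFDeriv_rescaled_le (H : AxisymmetricL3Hyp ν T u p)
    (x₀ : EuclideanSpace ℝ (Fin 3)) {R ρ K₀ : ℝ} (hRpos : 0 < R) (hRρ : R ≤ ρ)
    (hβρ : R ^ 2 / ν ≤ ρ ^ 2) (hρT : ρ ^ 2 ≤ T)
    (hK₀ : ∀ z ∈ parabolicCylinder ρ ((T : ℝ), x₀), ‖u z.1 z.2‖ ≤ K₀) (n : ℕ) :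
    ∃ K' : ℝ, ∀ w ∈ parabolicCylinder (1 / 2) (0 : ℝ × EuclideanSpace ℝ (Fin 3)),
      ‖iteratedFDeriv ℝ n (((R / ν) • stPull (R ^ 2 / ν) R T x₀ u) w.1) w.2‖ ≤ K' := by
  have hν := H.viscosity_pos
  set α : ℝ := R / ν with hα
  set β : ℝ := R ^ 2 / ν with hβdef
  have hαpos : 0 < α := by positivity
  have hβpos : 0 < β := by positivity
  have hβeq : β = α * R := by rw [hβdef, hα]; field_simp
  -- the gauged pressure and the `ν`-cylinder about `(T, x₀)`
  obtain ⟨q, hsuit, hqae, -⟩ := H.exists_gauged_pressure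
  have hcylslab : parabolicCylinder ρ ((T : ℝ), x₀) ⊆
      Ioo 0 T ×ˢ (univ : Set (EuclideanSpace ℝ (Fin 3))) := by
    intro z hz
    rw [mem_parabolicCylinder] at hz
    exact ⟨⟨by nlinarith [hz.1.1], hz.1.2⟩, mem_univ _⟩
  set PO : TopologicalSpace.Opens (ℝ × EuclideanSpace ℝ (Fin 3)) :=
    ⟨Ioo (T - β) T ×ˢ ball x₀ R, isOpen_Ioo.prod isOpen_ball⟩ with hPO
  have hPOcyl : (PO : Set (ℝ × EuclideanSpace ℝ (Fin 3))) ⊆ parabolicCylinder ρ ((T : ℝ), x₀) := by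
    rintro ⟨t, x⟩ ⟨ht, hx⟩
    rw [mem_parabolicCylinder]
    refine ⟨⟨by linarith [ht.1], ht.2⟩, ?_⟩
    rw [mem_ball] at hx
    exact lt_of_lt_of_le hx hRρ
  have hPOslab : (PO : Set (ℝ × EuclideanSpace ℝ (Fin 3))) ⊆
      Ioo 0 T ×ˢ (univ : Set (EuclideanSpace ℝ (Fin 3))) := hPOcyl.trans hcylslab
  -- `Φ⁻¹(PO) = Q(0, 1)`
  have hpre1 : stPreimage β R T x₀ PO =
      parabolicCylinderOpens 1 (0 : ℝ × EuclideanSpace ℝ (Fin 3)) := by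
    apply TopologicalSpace.Opens.ext
    rw [coe_stPreimage]
    have h := stAffine_preimage_cylinder_eq_parabolicCylinder hν hRpos T x₀ R
    rw [div_self hRpos.ne'] at h
    exact h
  have hQ1 : parabolicCylinder 1 (0 : ℝ × EuclideanSpace ℝ (Fin 3)) =
      stAffine β R T x₀ ⁻¹' (PO : Set (ℝ × EuclideanSpace ℝ (Fin 3))) := by
    rw [← coe_stPreimage, hpre1]; rfl
  -- the rescaled pair is a suitable weak solution of the unit-viscosity system on `Q(0, 1)`
  have hsuit1 : IsSuitableWeakSolutionOn (parabolicCylinderOpens 1 (0 : ℝ × EuclideanSpace ℝ (Fin 3)))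
      1 0 (α • stPull β R T x₀ u) (α ^ 2 • stPull β R T x₀ q) := by
    have h0 := (hsuit PO hPOslab).stRescale hαpos hRpos hβeq T x₀
    have hvisc : α * ν / R = 1 := by
      rw [hα, div_mul_cancel₀ R hν.ne', div_self hRpos.ne']
    have hforce : ((α ^ 2 * R) • stPull β R T x₀
        (0 : ℝ → EuclideanSpace ℝ (Fin 3) → EuclideanSpace ℝ (Fin 3))) = 0 := by
      funext s y; simp [stPull]
    rw [hvisc, hforce, hpre1] at h0
    exact h0
  -- the bound `|v| ≤ α K₀` on `Q(0, 1)` (everywhere, hence a.e.)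
  have hbd1 : ∀ᵐ w ∂(volume.restrict (parabolicCylinder 1 (0 : ℝ × EuclideanSpace ℝ (Fin 3)))),
      ‖(α • stPull β R T x₀ u) w.1 w.2‖ ≤ α * K₀ := by
    refine (ae_restrict_mem (isOpen_parabolicCylinder 1 _).measurableSet).mono fun w hw => ?_
    rw [hQ1] at hw
    have h := hK₀ _ (hPOcyl hw)
    rw [stAffine_fst, stAffine_snd] at h
    rw [smul_stPull_apply, norm_smul, Real.norm_of_nonneg hαpos.le]
    exact mul_le_mul_of_nonneg_left h hαpos.le
  -- `π ∈ L^{3/2}(Q(0, 1))`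
  have hp1 : ∫⁻ w in parabolicCylinder 1 (0 : ℝ × EuclideanSpace ℝ (Fin 3)),
      ‖(α ^ 2 • stPull β R T x₀ q) w.1 w.2‖ₑ ^ (3 / 2 : ℝ) < ∞ := by
    rw [hQ1, setLIntegral_enorm_rpow_stRescale hβpos hRpos T x₀ (α ^ 2) q _ (by norm_num)]
    refine ENNReal.mul_lt_top (ENNReal.mul_lt_top
      (ENNReal.rpow_lt_top_of_nonneg (by norm_num) enorm_ne_top) ENNReal.ofReal_lt_top) ?_
    exact lt_of_le_of_lt (lintegral_mono_set hPOcyl)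
      (H.lintegral_cylinder_gauged_pressure_lt_top hqae hρT x₀)
  -- higher interior regularity of bounded distributional solutions
  obtain ⟨V, hae, -, hHol⟩ := NSBoundedHigherRegularity_holds _ _
    (0 : ℝ × EuclideanSpace ℝ (Fin 3)) 1 (α * K₀) hsuit1.distributional hbd1 hp1
  -- both `v` and its smooth representative are continuous on `Q(0, 1)`, so they agree there
  have hVc : ContinuousOn (uncurry V) (parabolicCylinder 1 (0 : ℝ × EuclideanSpace ℝ (Fin 3))) :=
    continuousOn_uncurry_of_holder_exhaustion (hHol 0)
  have hvc : ContinuousOn (uncurry (α • stPull β R T x₀ u))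
      (parabolicCylinder 1 (0 : ℝ × EuclideanSpace ℝ (Fin 3))) := by
    have hmaps : MapsTo (stAffine β R T x₀) (parabolicCylinder 1 (0 : ℝ × EuclideanSpace ℝ (Fin 3)))
        (Ioo 0 T ×ˢ (univ : Set (EuclideanSpace ℝ (Fin 3)))) := by
      intro w hw
      rw [hQ1] at hw
      exact hPOslab hw
    have h1 : ContinuousOn (fun w => uncurry u (stAffine β R T x₀ w))
        (parabolicCylinder 1 (0 : ℝ × EuclideanSpace ℝ (Fin 3))) :=
      H.classical_Ioo.smooth_velocity.continuousOn.comp (continuous_stAffine β R T x₀).continuousOn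
        hmaps
    exact h1.const_smul α
  have heq : EqOn (uncurry (α • stPull β R T x₀ u)) (uncurry V)
      (parabolicCylinder 1 (0 : ℝ × EuclideanSpace ℝ (Fin 3))) :=
    Measure.eqOn_open_of_ae_eq hae (isOpen_parabolicCylinder 1 _) hvc hVc
  -- the Hölder bound on `Q(0, 1/2)` for `DⁿV`, transferred to `Dⁿv`, gives the bound
  obtain ⟨C, a, -, hC⟩ := hHol n (1 / 2) ⟨by norm_num, by norm_num⟩
  have hsub : parabolicCylinder (1 / 2) (0 : ℝ × EuclideanSpace ℝ (Fin 3)) ⊆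
      parabolicCylinder 1 (0 : ℝ × EuclideanSpace ℝ (Fin 3)) := by
    intro w hw
    rw [mem_parabolicCylinder_zero_iff] at hw ⊢
    exact ⟨⟨by nlinarith [hw.1.1], hw.1.2⟩, hw.2.trans (by norm_num)⟩
  exact exists_forall_norm_le_of_holderOnWith_half
    (holderOnWith_iteratedFDeriv_of_eqOn (isOpen_parabolicCylinder 1 _) heq n hsub hC)

/-- **Unscaling the derivative bounds.** If every `n`-th spatial derivative of the rescaled field
`v(s, y) = (R/ν) u(T + (R²/ν) s, x₀ + R y)` is bounded by `K'` on `Q(0, 1/2)`, then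
`‖Dⁿu(t)(x)‖ ≤ (R/ν)⁻¹ R⁻ⁿ K'` on `(T - r², T) × B(x₀, r)`, `r = min (R/2) (√(R²/ν)/2)`: for such
`(t, x)` the point `(s, y) = ((t - T)/(R²/ν), R⁻¹(x - x₀))` lies in `Q(0, 1/2)` and
`u t = (R/ν)⁻¹ • v s (R⁻¹ • (· - x₀))`. [folklore] -/
theorem exists_bound_iteratedFDeriv_of_rescaled {R K' : ℝ} {x₀ : EuclideanSpace ℝ (Fin 3)} {n : ℕ}
    (hν : 0 < ν) (hR : 0 < R)
    (hK' : ∀ w ∈ parabolicCylinder (1 / 2) (0 : ℝ × EuclideanSpace ℝ (Fin 3)),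
      ‖iteratedFDeriv ℝ n (((R / ν) • stPull (R ^ 2 / ν) R T x₀ u) w.1) w.2‖ ≤ K') :
    ∃ r > 0, ∃ K : ℝ, ∀ t ∈ Ioo (T - r ^ 2) T, ∀ x ∈ ball x₀ r,
      ‖iteratedFDeriv ℝ n (u t) x‖ ≤ K := by
  set α : ℝ := R / ν with hα
  set β : ℝ := R ^ 2 / ν with hβdef
  have hαpos : 0 < α := by positivity
  have hβpos : 0 < β := by positivity
  refine ⟨min (R / 2) (Real.sqrt β / 2), lt_min (by positivity) (by positivity),
    α⁻¹ * R⁻¹ ^ n * K', fun t ht x hx => ?_⟩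
  have hrR : min (R / 2) (Real.sqrt β / 2) ≤ R / 2 := min_le_left _ _
  have hr0 : 0 < min (R / 2) (Real.sqrt β / 2) := lt_min (by positivity) (by positivity)
  have hrβ : (min (R / 2) (Real.sqrt β / 2)) ^ 2 ≤ β / 4 := by
    have h1 : min (R / 2) (Real.sqrt β / 2) ≤ Real.sqrt β / 2 := min_le_right _ _
    have h2 : (min (R / 2) (Real.sqrt β / 2)) ^ 2 ≤ (Real.sqrt β / 2) ^ 2 :=
      pow_le_pow_left₀ hr0.le h1 2
    rw [div_pow, Real.sq_sqrt hβpos.le] at h2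
    linarith
  -- the rescaled point
  set s : ℝ := (t - T) / β with hs
  have hw : ((s, R⁻¹ • (x - x₀)) : ℝ × EuclideanSpace ℝ (Fin 3)) ∈
      parabolicCylinder (1 / 2) (0 : ℝ × EuclideanSpace ℝ (Fin 3)) := by
    rw [mem_parabolicCylinder_zero_iff]
    refine ⟨⟨?_, ?_⟩, ?_⟩
    · show -(1 / 2 : ℝ) ^ 2 < (t - T) / β
      have h1 : -(β / 4) < t - T := by nlinarith [ht.1]
      rw [lt_div_iff₀ hβpos]
      nlinarith
    · show (t - T) / β < 0
      exact div_neg_of_neg_of_pos (by linarith [ht.2]) hβpos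
    · show ‖R⁻¹ • (x - x₀)‖ < 1 / 2
      rw [norm_smul, Real.norm_of_nonneg (inv_nonneg.2 hR.le), inv_mul_lt_iff₀ hR]
      rw [mem_ball, dist_eq_norm] at hx
      linarith
  -- `u t` in terms of the rescaled slice `v s`
  have hts : T + β * s = t := by
    rw [hs]; field_simp; ring
  have hfun : u t = fun x' => α⁻¹ • ((α • stPull β R T x₀ u) s) (R⁻¹ • (x' - x₀)) := by
    funext x'
    rw [smul_stPull_apply, hts, smul_smul, inv_mul_cancel₀ hαpos.ne', one_smul, smul_smul,
      mul_inv_cancel₀ hR.ne', one_smul, add_sub_cancel]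
  rw [hfun]
  calc ‖iteratedFDeriv ℝ n (fun x' => α⁻¹ • ((α • stPull β R T x₀ u) s) (R⁻¹ • (x' - x₀))) x‖
      ≤ |α⁻¹| * |R⁻¹| ^ n *
          ‖iteratedFDeriv ℝ n ((α • stPull β R T x₀ u) s) (R⁻¹ • (x - x₀))‖ :=
        norm_iteratedFDeriv_smul_comp_affine_le _ _ (inv_ne_zero hR.ne') x₀ n x
    _ ≤ α⁻¹ * R⁻¹ ^ n * K' := by
        have hb : ‖iteratedFDeriv ℝ n ((α • stPull β R T x₀ u) s) (R⁻¹ • (x - x₀))‖ ≤ K' :=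
          hK' (s, R⁻¹ • (x - x₀)) hw
        rw [abs_of_pos (inv_pos.2 hαpos), abs_of_pos (inv_pos.2 hR)]
        exact mul_le_mul_of_nonneg_left hb (by positivity)

end Witness

/-! ### The registered stub -/

/-- **Higher regularity at the regular top points** (registered stub of
stmt-NavierStokesRegularity-0727, line `compact-amplification`): for a classical solution `(u, p)`
of the unforced Navier–Stokes system with viscosity `ν > 0` on `[0, T)`, Leray–Hopf on `[0, T]`
from a rapidly decaying axisymmetric datum, local boundedness of `u` on a backward parabolic
neighbourhood of a top point `(T, x₀)` implies, for every order `n`, a bound on `Dⁿu(t)(x)` on a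
backward parabolic neighbourhood `(T - r², T) × B(x₀, r)` of `(T, x₀)`. Proof: the scales
`R = min (√T/(2κ)) (r₀/κ)`, `κ = 2 + 1/√ν`, `ρ = Rκ` put the `ν`-cylinder
`(T - R²/ν, T) × B(x₀, R)` inside `Q((T, x₀), ρ) ⊆ Q((T, x₀), r₀)`, the region of boundedness,
with `ρ² ≤ T`; then `exists_forall_norm_iteratedFDeriv_rescaled_le` (the unit-viscosity
rescaling, `NSBoundedHigherRegularity_holds`) and `exists_bound_iteratedFDeriv_of_rescaled`
(unscaling). [cite: KochNadirashviliSereginSverak2009, §4 (regularity of bounded mild solutions)]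
[cite: Serrin1962, interior regularity] [cite: SereginSverak2009, §3] -/
theorem iteratedFDeriv_bounded_near_top_of_isBoundedNearTop : ∀ {ν T : ℝ} {u : ℝ → EuclideanSpace ℝ (Fin 3) → EuclideanSpace ℝ (Fin 3)} {p : ℝ → EuclideanSpace ℝ (Fin 3) → ℝ}, 0 < ν → 0 < T → IsClassicalNSSolutionOn (Set.Ico 0 T) ν 0 u p → IsLerayHopfOn T ν 0 (u 0) u → HasRapidSpatialDecay (u 0) → IsAxisymmetric (u 0) → ∀ x₀ : EuclideanSpace ℝ (Fin 3), IsBoundedNearTop u T x₀ → ∀ n : ℕ, ∃ r > 0, ∃ K : ℝ, ∀ t ∈ Set.Ioo (T - r ^ 2) T, ∀ x ∈ Metric.ball x₀ r, ‖iteratedFDeriv ℝ n (u t) x‖ ≤ K := by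
  intro ν T u p hν hT hcl hLH hdec haxi x₀ hbd n
  have H : AxisymmetricL3Hyp ν T u p := axisymmetricL3Hyp_of_lerayHopf_classical hν hT hcl hLH hdec haxi
  obtain ⟨r₀, hr₀, K₀, hK₀⟩ := hbd
  -- scales: `R κ ≤ min (√T / 2) r₀`, `κ = 2 + 1/√ν`
  set κ : ℝ := 2 + (Real.sqrt ν)⁻¹ with hκ
  have hκpos : 0 < κ := by positivity
  have hκ1 : 1 ≤ κ := by
    have : 0 ≤ (Real.sqrt ν)⁻¹ := by positivity
    linarith
  set R : ℝ := min (Real.sqrt T / (2 * κ)) (r₀ / κ) with hR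
  have hRpos : 0 < R := lt_min (by positivity) (by positivity)
  set ρ : ℝ := R * κ with hρ
  have hρT : ρ ^ 2 ≤ T := by
    have h1 : ρ ≤ Real.sqrt T / 2 := by
      have : R ≤ Real.sqrt T / (2 * κ) := min_le_left _ _
      rw [hρ]
      calc R * κ ≤ Real.sqrt T / (2 * κ) * κ := mul_le_mul_of_nonneg_right this hκpos.le
        _ = Real.sqrt T / 2 := by field_simp
    have h2 : ρ ^ 2 ≤ (Real.sqrt T / 2) ^ 2 := pow_le_pow_left₀ (by positivity) h1 2
    rw [div_pow, Real.sq_sqrt hT.le] at h2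
    linarith
  have hβρ : R ^ 2 / ν ≤ ρ ^ 2 := by
    have h1 : R ^ 2 / ν = (R * (Real.sqrt ν)⁻¹) ^ 2 := by
      rw [mul_pow, inv_pow, Real.sq_sqrt hν.le, div_eq_mul_inv]
    rw [h1, hρ]
    have h2 : (Real.sqrt ν)⁻¹ ≤ κ := by rw [hκ]; linarith
    have h3 : 0 ≤ (Real.sqrt ν)⁻¹ := by positivity
    exact pow_le_pow_left₀ (by positivity) (mul_le_mul_of_nonneg_left h2 hRpos.le) 2
  have hRρ : R ≤ ρ := by
    rw [hρ]
    nlinarith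
  have hρr₀ : ρ ≤ r₀ := by
    have : R ≤ r₀ / κ := min_le_right _ _
    rw [hρ]
    calc R * κ ≤ r₀ / κ * κ := mul_le_mul_of_nonneg_right this hκpos.le
      _ = r₀ := by field_simp
  -- `u` is bounded by `K₀` on `Q((T, x₀), ρ)`
  have hK₀' : ∀ z ∈ parabolicCylinder ρ ((T : ℝ), x₀), ‖u z.1 z.2‖ ≤ K₀ := by
    intro z hz
    rw [mem_parabolicCylinder] at hz
    have hsq : ρ ^ 2 ≤ r₀ ^ 2 := pow_le_pow_left₀ (by positivity) hρr₀ 2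
    refine hK₀ z.1 ⟨by nlinarith [hz.1.1], hz.1.2⟩ z.2 ?_
    rw [mem_ball]
    exact lt_of_lt_of_le hz.2 hρr₀
  obtain ⟨K', hK'⟩ := exists_forall_norm_iteratedFDeriv_rescaled_le H x₀ hRpos hRρ hβρ hρT hK₀' n
  exact exists_bound_iteratedFDeriv_of_rescaled hν hRpos hK'

end Summit.NavierStokesRegularity.NavierStokesRegularity.Theorems.CertifiedBlowupAxisymBlowup.CompactAmplification

end
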